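import Summits.QuantumFields.YangMills.Theorems.FluctuationComparisonRegPrIntLS2BetaRelativeMemberLetters
import Summits.QuantumFields.YangMills.Theorems.FluctuationComparisonRegPrIntLS2BetaRelativeChainCoupling
import Summits.QuantumFields.YangMills.Theorems.FluctuationComparisonRegPrIntLS2BetaFieldPackage
import HarnessLib

/-!
# S2β · letter (D♮) REL-TEL, the (C)-half — ★★★ THE RELATIVE (C)-STEP (relative twin of ✓`…S2BetaOneLevelStep.oneLevelStep`):
# `dist1 (Ū₀(∂Q)⁻¹·Ū(∂Q)) ≤ (1 + 26·((d+2)L)²θ)·Σ_p K Q p·dist1 (U₀(∂p)⁻¹U(∂p)) + 1.5·10⁶·((d+2)L)²θ·β + 5·L³θ·γ`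
# for the (0.4) averaging with the printed `exp[mean log]` on `SU(N)` — MAIN TERM = px12's tent kernel on the RELATIVE plaquette function (exact `√L`),
# JUNK = (global plaquette SIZE θ) × (LOCAL RELATIVE data: `β` = relative member loops ∕ axial transports ∕ staircases at `Q`, `γ` = forward-near bond deviations);
# EVERY right-hand term vanishes at `U = U₀`

Cell `ym3-torus` (rung R3 = continuum `SU(2)` Yang–Mills on the three-torus — NOT d = 4, NOT infinite volume, NOT a mass gap, NOT Clay).
Width seat «width 10» `ym3-torus-px10` (gen 23), FREE px helper on crux `stmt-QuantumFields-20520` (`Theses.UnitScaleTilt.FluctuationComparisonRegPrIntL`), count-neutral,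
DEFINITION-FREE; own-risk brick of the px10 lane «(C)-half of letter (D♮)» (px16 g21 «GO BRICK 1» 11:28:01Z, «GO (R-Cauchy)» 12:12:40Z; UV3-NODE §82; ★★OWNER RULING №88:
(D♮) «∃ residual w, `N⁻²·d²(U, w•U₀) ≤ C_D·REL(U; w•U₀)`» is a letter of record of the registered `stub_uniformFibreGapOrbit`).

THE STEP (one level `j → j+1`, `Ū = avgFun ℰ U`, `Ū₀ = avgFun ℰ U₀`, `ℰ = expMeanLogSU`; both fields `PlaqSmall θ` with `((d+2)L)²θ ≤ 1∕400`, `((d+2)L)²∕4·θ < δ_N`;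
`τ := ((d+2)L)²θ∕4`).  Write `log Ū(∂Q) = J₁₀(p) + chain(p) − J₁₄(p)` with `p = (a₁,a₂,a₃,a₄,H₀)` the member-logarithm tuple of ✓G9's loop form (✓`…OneLevelStep`'s decomposition,
for EACH field).  Then `log Ū(∂Q) − log Ū₀(∂Q)` is the sum of (i) `ΔJ₁₀` — ✓`…SizeLipschitzByCauchy.norm_hybrid4_sub_hybrid4_le`: `≤ 4096(e^{64τ}−1)·δ_a`; (ii) `ΔJ₁₄` —
✓`…RelativeChainCoupling.norm_chain4_sub_chain4_le`: `≤ 4096((e^{48τ}−1)+(e^{32τ}−1)+(e^{16τ}−1))·δ_a`; (iii) `Δchain` — ✓`…RelativeMemberLetters.mean_norm_mlog_conjRect_sub_le`: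
`≤ (1 + 2L²θ)(ΣK·δ_p + 4L³θγ + 2L²θβ)`; where `δ_a ≤ 4β` is the sup of the relative member logarithms and of the relative context (`…RelativeMemberLetters` §1–§2: `log`
2-Lipschitz, coupled members conjugated by relative transports of size `≤ β, 3β, 4β`); and the exit `dist1 (Ū₀(∂Q)⁻¹Ū(∂Q)) ≤ e^{50τ}·‖log Ū(∂Q) − log Ū₀(∂Q)‖`
(✓`dist1_rel_le_mul_norm_mlog_sub`).  Numerics: `e^{x} − 1 ≤ 2x` on `[0,1]`.

HONEST SCOPE.  A composition of landed bookkeeping∕Cauchy letters with explicit admissible (not optimal) constants; the analytic inputs are ✓G10∕✓G14 (through their relative editions),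
lit (21)∕(26)–(27) and Mathlib's Schwarz lemma; nothing of Bałaban's renormalisation analysis ([Balaban1985RegularSpaces] Lemma 1 ∕ Thm 2 — relative in gauge, absolute in size)
is asserted as proved; the relative KEY LEMMA tower, the `ℓ²` conversion of `β` (relative words ≤ sums of bond deviations), (D♮), (F♮), GAP♯∘ (`stub_uniformFibreGapOrbit`), S2β,
crux 20520 and `YM3TorusSU2` are NOT proved; no registered stub is closed; the Yang–Mills mass gap is NOT proved.  Sorry-free, axioms standard.
References: T. Bałaban, CMP **109** (1987) 249–301 [Balaban1987RG1] ((0.4)–(0.8) p.253); CMP **98** (1985) 17–51 [Balaban1985Averaging] ((19) p.21, (21) p.21, (26)–(27) p.22);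
CMP **99** (1985) 75–102 [Balaban1985RegularSpaces] (Lemma 1 p.79 (1.21)–(1.26): the printed one-step locus at a background).
-/

set_option autoImplicit false

noncomputable section

namespace Summit.QuantumFields.YangMills.Theorems.FluctuationComparisonRegPrIntLS2BetaRelativeOneLevelStep

open NormedSpace Finset
open scoped BigOperators Matrix.Norms.L2Operator
open Literature.MathematicalPhysics.QuantumFieldTheory.Balaban1983to89
open Literature.MathematicalPhysics.QuantumFieldTheory.Balaban1983to89.T4Continuum
open Literature.MathematicalPhysics.QuantumFieldTheory.Balaban1983to89.AveragingRT
open Literature.MathematicalPhysics.QuantumFieldTheory.Balaban1983to89.BlockAveraging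
open Literature.MathematicalPhysics.QuantumFieldTheory.Balaban1983to89.MatrixLog (mlog exp_mlog norm_mlog_le_two_mul)
open Literature.MathematicalPhysics.QuantumFieldTheory.Balaban1983to89.ExpMeanLog (expMeanLogSU deltaSU)
open Literature.MathematicalPhysics.QuantumFieldTheory.Balaban1983to89.LatticeWordStokes (dist1_loopHol_le small_of_plaqSmall)
open Literature.MathematicalPhysics.QuantumFieldTheory.Balaban1983to89.T4TiltOscillation (bdev)
open B10Eq47AxialChi (shiftN rect plaqSmall_axialAvg)
open Summit.QuantumFields.YangMills.Theorems.FluctuationComparisonRegPrIntLS2BetaOneLevelStepLetters (coe_avg_eq_exp_mean norm_mean_le_mean memberWord_eq_conj_rect sq_L_le_quarter)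
open Summit.QuantumFields.YangMills.Theorems.FluctuationComparisonRegPrIntLS2BetaRelativeStokes (dist1_rel_mul_le dist1_rel_inv dist1_comm_le_SU)
open Summit.QuantumFields.YangMills.Theorems.FluctuationComparisonRegPrIntLS2BetaRelativeMemberLetters (norm_coe_sub_coe_eq_dist1_rel norm_mlog_sub_mlog_le_two_mul_dist1
  dist1_rel_le_mul_norm_mlog_sub dist1_rel_conj_le' dist1_rel_conj_inv_le dist1_rel_prod3_le dist1_rel_prod4_le mean_norm_mlog_conjRect_sub_le)
open Summit.QuantumFields.YangMills.Theorems.FluctuationComparisonRegPrIntLS2BetaSizeLipschitzByCauchy (norm_hybrid4_sub_hybrid4_le)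
open Summit.QuantumFields.YangMills.Theorems.FluctuationComparisonRegPrIntLS2BetaRelativeChainCoupling (norm_chain4_sub_chain4_le)
open Summit.QuantumFields.YangMills.Theorems.FluctuationComparisonRegPrIntLS2BetaFieldPackage (field_package)

variable {n : Type*} [Fintype n] [DecidableEq n] [Nonempty n]
variable {P : Params} {j : ℕ}

/-! ## §2 The relative (C)-step -/

set_option maxHeartbeats 400000 in
/-- ★★★ **THE RELATIVE (C)-STEP** (`SU(N)`, `ℰ = expMeanLogSU`, standing range; both fields `PlaqSmall θ`, `((d+2)L)²θ ≤ 1∕400`, `((d+2)L)²∕4·θ < δ_N`; LOCAL RELATIVE DATA at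
the coarse plaquette `Q = ⟨y; μ, ν⟩`: `β ≥` the relative sizes `dist1 (X(U₀)⁻¹·X(U))` of every (0.4) member loop and of the axial transport at each of the four bonds of `Q`, and of
every staircase transport `U(Γ^σ_{y,x_r})`; `γ ≥` the bond deviations `dist1 (U₀(c)⁻¹U(c))` on the forward-near blocks `blockOf c₋ κ ∈ {y κ, y κ + 1}`):
`dist1 (Ū₀(∂Q)⁻¹·Ū(∂Q)) ≤ (1 + 26·((d+2)L)²θ)·Σ_p K Q p·dist1 (U₀(∂p)⁻¹U(∂p)) + 1500000·((d+2)L)²θ·β + 5·L³·θ·γ` with `K` px12 g23's one-level tent kernel VERBATIM — the MAIN TERM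
keeps the exact constant `1 + O(θ)` on the RELATIVE plaquette function, the JUNK is (global size) × (local RELATIVE data), and every term vanishes at `U = U₀`.
[cite: Balaban1987RG1, (0.4)-(0.8) p.253] -/
theorem relOneLevelStep (hj : j + 1 ≤ P.m + P.K) (U U₀ : GaugeField P j (Matrix.specialUnitaryGroup n ℂ)) {θ : ℝ} (hθ0 : 0 ≤ θ)
    (hθ : (((P.d + 2) * P.L : ℕ) : ℝ) ^ 2 * θ ≤ 1 / 400) (hδ : (((P.d + 2) * P.L : ℕ) : ℝ) ^ 2 / 4 * θ < deltaSU n)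
    (hU : PlaqSmall θ U) (hU₀ : PlaqSmall θ U₀) (Q : Plaq P (j + 1)) {β γ : ℝ} (hβ0 : 0 ≤ β)
    (hW : ∀ c : PBond P (j + 1), (c = ⟨Q.src, Q.μ⟩ ∨ c = ⟨Q.src.shift Q.μ, Q.ν⟩ ∨ c = ⟨Q.src.shift Q.ν, Q.μ⟩ ∨ c = ⟨Q.src, Q.ν⟩) →
      ∀ i, dist1 ((loopHol U₀ c i)⁻¹ * loopHol U c i) ≤ β)
    (hA : ∀ c : PBond P (j + 1), (c = ⟨Q.src, Q.μ⟩ ∨ c = ⟨Q.src.shift Q.μ, Q.ν⟩ ∨ c = ⟨Q.src.shift Q.ν, Q.μ⟩ ∨ c = ⟨Q.src, Q.ν⟩) →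
      dist1 ((axialAvg U₀ c)⁻¹ * axialAvg U c) ≤ β)
    (hS : ∀ i : Idx P, dist1 ((holAt U₀ (walk (emb Q.src) (stairWord i.2.1 (off i.1))))⁻¹ * holAt U (walk (emb Q.src) (stairWord i.2.1 (off i.1)))) ≤ β)
    (hdev : ∀ c : PBond P j, (∀ κ, blockOf c.src κ = Q.src κ ∨ blockOf c.src κ = Q.src κ + 1) → dist1 (bdev U U₀ c) ≤ γ) :
    dist1 ((GaugeField.plaqHol (avgFun (expMeanLogSU (n := n)) U₀) Q)⁻¹ * GaugeField.plaqHol (avgFun (expMeanLogSU (n := n)) U) Q) ≤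
      (1 + 26 * ((((P.d + 2) * P.L : ℕ) : ℝ) ^ 2 * θ)) *
          ∑ p : Plaq P j, ((P.L : ℝ) ^ P.d)⁻¹ * (((block Q.src).filter (fun x : Site P j => p.μ = Q.μ ∧ p.ν = Q.ν ∧
            ∃ a ∈ range P.L, ∃ b ∈ range P.L, p.src = shiftN (shiftN x Q.μ a) Q.ν b)).card : ℝ) *
            dist1 ((GaugeField.plaqHol U₀ p)⁻¹ * GaugeField.plaqHol U p) +
        1500000 * ((((P.d + 2) * P.L : ℕ) : ℝ) ^ 2 * θ) * β + 5 * (P.L : ℝ) ^ 3 * θ * γ := by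
  -- ### the two packages (before the abbreviations, so that `set` rewrites them)
  have hθ50 : (((P.d + 2) * P.L : ℕ) : ℝ) ^ 2 * θ ≤ 1 / 50 := hθ.trans (by norm_num)
  obtain ⟨hgU, hHnU, hplaqMU, hm50U, hplaqU⟩ := field_package hj U hθ0 hθ50 hδ hU Q
  obtain ⟨hgU₀, hHnU₀, hplaqMU₀, hm50U₀, hplaqU₀⟩ := field_package hj U₀ hθ0 hθ50 hδ hU₀ Q
  -- ### thresholds
  set cc : ℝ := (((P.d + 2) * P.L : ℕ) : ℝ) ^ 2 / 4 with hcc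
  set τ : ℝ := cc * θ with hτdef
  have hcc0 : 0 ≤ cc := by positivity
  have hτ0 : 0 ≤ τ := mul_nonneg hcc0 hθ0
  have hτs : τ ≤ 1 / 1600 := by rw [hτdef, hcc]; linarith only [hθ]
  have h4τ : (((P.d + 2) * P.L : ℕ) : ℝ) ^ 2 * θ = 4 * τ := by rw [hτdef, hcc]; ring
  have hL2 : (P.L : ℝ) ^ 2 * θ ≤ τ := by rw [hτdef]; exact mul_le_mul_of_nonneg_right (sq_L_le_quarter P) hθ0
  -- `θ > 0`: a plaquette exists and `0 ≤ dist1 < θ`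
  have hθpos : 0 < θ := lt_of_le_of_lt (GaugeGroup.dist1_nonneg _) (hU ⟨emb Q.src, Q.μ, Q.ν, Q.hμν⟩)
  have hτpos : 0 < τ := by
    rw [hτdef, hcc]
    have : (0 : ℝ) < (((P.d + 2) * P.L : ℕ) : ℝ) ^ 2 / 4 := by
      have hpos : (0 : ℝ) < (((P.d + 2) * P.L : ℕ) : ℝ) := by
        have : 0 < (P.d + 2) * P.L := Nat.mul_pos (by omega) P.L_pos
        exact_mod_cast this
      positivity
    exact mul_pos this hθpos
  -- ### abbreviations
  set ℰ : LoopAverage (Matrix.specialUnitaryGroup n ℂ) := expMeanLogSU (n := n) with hℰ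
  set c₁ : PBond P (j + 1) := ⟨Q.src, Q.μ⟩ with hc₁
  set c₂ : PBond P (j + 1) := ⟨Q.src.shift Q.μ, Q.ν⟩ with hc₂
  set c₃ : PBond P (j + 1) := ⟨Q.src.shift Q.ν, Q.μ⟩ with hc₃
  set c₄ : PBond P (j + 1) := ⟨Q.src, Q.ν⟩ with hc₄
  set A₁ := axialAvg U c₁ with hA₁
  set A₂ := axialAvg U c₂ with hA₂
  set A₃ := axialAvg U c₃ with hA₃
  set A₄ := axialAvg U c₄ with hA₄
  set B₁ := axialAvg U₀ c₁ with hB₁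
  set B₂ := axialAvg U₀ c₂ with hB₂
  set B₃ := axialAvg U₀ c₃ with hB₃
  set B₄ := axialAvg U₀ c₄ with hB₄
  set P₃ := A₁ * A₂ * A₃⁻¹ with hP₃
  set P₃' := B₁ * B₂ * B₃⁻¹ with hP₃'
  set H₀ := A₁ * A₂ * A₃⁻¹ * A₄⁻¹ with hH₀
  set H₀' := B₁ * B₂ * B₃⁻¹ * B₄⁻¹ with hH₀'
  set W₁ : Idx P → Matrix.specialUnitaryGroup n ℂ := fun i => loopHol U c₁ i with hW₁
  set W₂ : Idx P → Matrix.specialUnitaryGroup n ℂ := fun i => A₁ * loopHol U c₂ i * A₁⁻¹ with hW₂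
  set W₃ : Idx P → Matrix.specialUnitaryGroup n ℂ := fun i => P₃ * (loopHol U c₃ i)⁻¹ * P₃⁻¹ with hW₃
  set W₄ : Idx P → Matrix.specialUnitaryGroup n ℂ := fun i => H₀ * (loopHol U c₄ i)⁻¹ * H₀⁻¹ with hW₄
  set V₁ : Idx P → Matrix.specialUnitaryGroup n ℂ := fun i => loopHol U₀ c₁ i with hV₁
  set V₂ : Idx P → Matrix.specialUnitaryGroup n ℂ := fun i => B₁ * loopHol U₀ c₂ i * B₁⁻¹ with hV₂
  set V₃ : Idx P → Matrix.specialUnitaryGroup n ℂ := fun i => P₃' * (loopHol U₀ c₃ i)⁻¹ * P₃'⁻¹ with hV₃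
  set V₄ : Idx P → Matrix.specialUnitaryGroup n ℂ := fun i => H₀' * (loopHol U₀ c₄ i)⁻¹ * H₀'⁻¹ with hV₄
  set a₁ : Idx P → Matrix n n ℂ := fun i => mlog (W₁ i : Matrix n n ℂ) with ha₁
  set a₂ : Idx P → Matrix n n ℂ := fun i => mlog (W₂ i : Matrix n n ℂ) with ha₂
  set a₃ : Idx P → Matrix n n ℂ := fun i => mlog (W₃ i : Matrix n n ℂ) with ha₃
  set a₄ : Idx P → Matrix n n ℂ := fun i => mlog (W₄ i : Matrix n n ℂ) with ha₄
  set b₁ : Idx P → Matrix n n ℂ := fun i => mlog (V₁ i : Matrix n n ℂ) with hb₁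
  set b₂ : Idx P → Matrix n n ℂ := fun i => mlog (V₂ i : Matrix n n ℂ) with hb₂
  set b₃ : Idx P → Matrix n n ℂ := fun i => mlog (V₃ i : Matrix n n ℂ) with hb₃
  set b₄ : Idx P → Matrix n n ℂ := fun i => mlog (V₄ i : Matrix n n ℂ) with hb₄
  have hN : (0 : ℝ) < Fintype.card (Idx P) := Nat.cast_pos.mpr Fintype.card_pos
  have hτh : τ ≤ 1 / 2 := by linarith only [hτs]
  -- ### (1) sizes of members and of their logarithms (both fields)
  have hgW₁ : ∀ i, dist1 (W₁ i) ≤ τ := fun i => (hgU i).1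
  have hgW₂ : ∀ i, dist1 (W₂ i) ≤ τ := fun i => (hgU i).2.1
  have hgW₃ : ∀ i, dist1 (W₃ i) ≤ τ := fun i => (hgU i).2.2.1
  have hgW₄ : ∀ i, dist1 (W₄ i) ≤ τ := fun i => (hgU i).2.2.2
  have hgV₁ : ∀ i, dist1 (V₁ i) ≤ τ := fun i => (hgU₀ i).1
  have hgV₂ : ∀ i, dist1 (V₂ i) ≤ τ := fun i => (hgU₀ i).2.1
  have hgV₃ : ∀ i, dist1 (V₃ i) ≤ τ := fun i => (hgU₀ i).2.2.1
  have hgV₄ : ∀ i, dist1 (V₄ i) ≤ τ := fun i => (hgU₀ i).2.2.2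
  have size : ∀ (W : Idx P → Matrix.specialUnitaryGroup n ℂ), (∀ i, dist1 (W i) ≤ τ) → ∀ i, ‖mlog (W i : Matrix n n ℂ)‖ ≤ 2 * τ := fun W hWτ i => by
    have h1 : ‖(W i : Matrix n n ℂ) - 1‖ ≤ 1 / 2 := (hWτ i).trans hτh
    exact (norm_mlog_le_two_mul h1).trans (by have h2 : ‖(W i : Matrix n n ℂ) - 1‖ ≤ τ := hWτ i; linarith only [h2])
  have hρa₁ : ∀ i, ‖a₁ i‖ ≤ 2 * τ := size W₁ hgW₁
  have hρa₂ : ∀ i, ‖a₂ i‖ ≤ 2 * τ := size W₂ hgW₂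
  have hρa₃ : ∀ i, ‖a₃ i‖ ≤ 2 * τ := size W₃ hgW₃
  have hρa₄ : ∀ i, ‖a₄ i‖ ≤ 2 * τ := size W₄ hgW₄
  have hρb₁ : ∀ i, ‖b₁ i‖ ≤ 2 * τ := size V₁ hgV₁
  have hρb₂ : ∀ i, ‖b₂ i‖ ≤ 2 * τ := size V₂ hgV₂
  have hρb₃ : ∀ i, ‖b₃ i‖ ≤ 2 * τ := size V₃ hgV₃
  have hρb₄ : ∀ i, ‖b₄ i‖ ≤ 2 * τ := size V₄ hgV₄
  -- ### (2) relative members: conjugation by relative transports costs SIZE × ARC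
  have hℓ : ∀ c i, dist1 (loopHol U c i) ≤ τ := fun c i => dist1_loopHol_le hθ0 hU c i
  have hA₁ : dist1 (B₁⁻¹ * A₁) ≤ β := hA c₁ (Or.inl rfl)
  have hA₂ : dist1 (B₂⁻¹ * A₂) ≤ β := hA c₂ (Or.inr (Or.inl rfl))
  have hA₃ : dist1 (B₃⁻¹ * A₃) ≤ β := hA c₃ (Or.inr (Or.inr (Or.inl rfl)))
  have hA₄ : dist1 (B₄⁻¹ * A₄) ≤ β := hA c₄ (Or.inr (Or.inr (Or.inr rfl)))
  have hP₃rel : dist1 (P₃'⁻¹ * P₃) ≤ 3 * β := by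
    have h := dist1_rel_prod3_le A₁ A₂ A₃ B₁ B₂ B₃; linarith only [h, hA₁, hA₂, hA₃]
  have hH₀rel : dist1 (H₀'⁻¹ * H₀) ≤ 4 * β := by
    have h := dist1_rel_prod4_le A₁ A₂ A₃ A₄ B₁ B₂ B₃ B₄; linarith only [h, hA₁, hA₂, hA₃, hA₄]
  have h8τ : 2 * τ * (4 * β) ≤ β := by nlinarith only [hτs, hτ0, hβ0]
  have hdW₁ : ∀ i, dist1 ((V₁ i)⁻¹ * W₁ i) ≤ 2 * β := fun i => (hW c₁ (Or.inl rfl) i).trans (by linarith only [hβ0])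
  have hdW₂ : ∀ i, dist1 ((V₂ i)⁻¹ * W₂ i) ≤ 2 * β := fun i => by
    have h := dist1_rel_conj_le' dist1_comm_le_SU (hℓ c₂ i) (hW c₂ (Or.inr (Or.inl rfl)) i) hA₁ (ℓ₀ := loopHol U₀ c₂ i) (T₀ := B₁)
    have h' : 2 * τ * β ≤ β := by nlinarith only [hτs, hτ0, hβ0]
    exact h.trans (by linarith only [h', hβ0])
  have hdW₃ : ∀ i, dist1 ((V₃ i)⁻¹ * W₃ i) ≤ 2 * β := fun i => by
    have h := dist1_rel_conj_inv_le dist1_comm_le_SU (hℓ c₃ i) (hW c₃ (Or.inr (Or.inr (Or.inl rfl))) i) hP₃rel (ℓ₀ := loopHol U₀ c₃ i) (T₀ := P₃')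
    have h' : 2 * τ * (3 * β) ≤ β := by nlinarith only [hτs, hτ0, hβ0]
    exact h.trans (by linarith only [h', hβ0])
  have hdW₄ : ∀ i, dist1 ((V₄ i)⁻¹ * W₄ i) ≤ 2 * β := fun i => by
    have h := dist1_rel_conj_inv_le dist1_comm_le_SU (hℓ c₄ i) (hW c₄ (Or.inr (Or.inr (Or.inr rfl))) i) hH₀rel (ℓ₀ := loopHol U₀ c₄ i) (T₀ := H₀')
    exact h.trans (by linarith only [h8τ, hβ0])
  -- ### (3) relative logarithms and context: `δ_a := 4β`
  have logrel : ∀ (W V : Idx P → Matrix.specialUnitaryGroup n ℂ), (∀ i, dist1 (W i) ≤ τ) → (∀ i, dist1 (V i) ≤ τ) →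
      (∀ i, dist1 ((V i)⁻¹ * W i) ≤ 2 * β) → ∀ i, ‖mlog (W i : Matrix n n ℂ) - mlog (V i : Matrix n n ℂ)‖ ≤ 4 * β := fun W V hWτ hVτ hd i =>
    (norm_mlog_sub_mlog_le_two_mul_dist1 (W i) (V i) ((hWτ i).trans hτh) ((hVτ i).trans hτh)).trans (by linarith only [hd i])
  have hda₁ : ∀ i, ‖a₁ i - b₁ i‖ ≤ 4 * β := logrel W₁ V₁ hgW₁ hgV₁ hdW₁
  have hda₂ : ∀ i, ‖a₂ i - b₂ i‖ ≤ 4 * β := logrel W₂ V₂ hgW₂ hgV₂ hdW₂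
  have hda₃ : ∀ i, ‖a₃ i - b₃ i‖ ≤ 4 * β := logrel W₃ V₃ hgW₃ hgV₃ hdW₃
  have hda₄ : ∀ i, ‖a₄ i - b₄ i‖ ≤ 4 * β := logrel W₄ V₄ hgW₄ hgV₄ hdW₄
  have hdH : ‖(H₀ : Matrix n n ℂ) - (H₀' : Matrix n n ℂ)‖ ≤ 4 * β := by rw [norm_coe_sub_coe_eq_dist1_rel]; exact hH₀rel
  have hβ4 : 0 ≤ 4 * β := by linarith only [hβ0]
  -- ### (4) the Cauchy letters: `ΔJ₁₀`, `ΔJ₁₄` with `ρ = 2τ`, `δ = 4β`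
  have h2τ0 : 0 < 2 * τ := by linarith only [hτpos]
  have h2τ : 2 * τ ≤ 1 / 800 := by linarith only [hτs]
  have hJ₁₀ := norm_hybrid4_sub_hybrid4_le b₁ b₂ b₃ b₄ a₁ a₂ a₃ a₄ (H₀' : Matrix n n ℂ) (H₀ : Matrix n n ℂ) h2τ0 h2τ
    hρb₁ hρb₂ hρb₃ hρb₄ hHnU₀ hρa₁ hρa₂ hρa₃ hρa₄ hHnU hβ4 hda₁ hda₂ hda₃ hda₄ hdH
  set τp : Equiv.Perm (Idx P) := Equiv.prodCongr (Equiv.refl _) (Equiv.prodComm _ _) with hτpdef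
  have hτp : ∀ i : Idx P, τp i = (i.1, i.2.2, i.2.1) := fun i => rfl
  have hJ₁₄ := norm_chain4_sub_chain4_le b₁ b₂ b₃ b₄ a₁ a₂ a₃ a₄ (H₀' : Matrix n n ℂ) (H₀ : Matrix n n ℂ) τp 1 τp h2τ0 h2τ
    hρb₁ hρb₂ hρb₃ hρb₄ hHnU₀ hρa₁ hρa₂ hρa₃ hρa₄ hHnU hβ4 hda₁ hda₂ hda₃ hda₄ hdH
  -- ### (5) the chain means are the means of the logarithms of the conjugated squares (✓`memberWord_eq_conj_rect`, for each field)
  have hexpW : ∀ (W : Idx P → Matrix.specialUnitaryGroup n ℂ), (∀ i, dist1 (W i) ≤ τ) → ∀ i, exp (mlog (W i : Matrix n n ℂ)) = (W i : Matrix n n ℂ) :=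
    fun W hW i => exp_mlog ((show ‖(W i : Matrix n n ℂ) - 1‖ ≤ τ from hW i).trans_lt (by linarith only [hτh]))
  have hone : ∀ x : Idx P, (1 : Equiv.Perm (Idx P)) x = x := fun x => rfl
  have hττ : ∀ i : Idx P, τp (τp i) = i := fun i => rfl
  have hchainU : ∀ i : Idx P, mlog (exp (a₁ i) * exp (a₂ (τp i)) * exp (a₃ ((1 : Equiv.Perm (Idx P)) (τp i))) *
      exp (a₄ (τp ((1 : Equiv.Perm (Idx P)) (τp i)))) * (H₀ : Matrix n n ℂ)) =
      mlog ((holAt U (walk (emb Q.src) (stairWord i.2.1 (off i.1))) * rect U (Site.blockSite Q.src i.1) Q.μ Q.ν P.L P.L *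
        (holAt U (walk (emb Q.src) (stairWord i.2.1 (off i.1))))⁻¹ : Matrix.specialUnitaryGroup n ℂ) : Matrix n n ℂ) := fun i => by
    rw [hone, hττ, ha₁, ha₂, ha₃, ha₄]
    simp only
    rw [hexpW W₁ hgW₁, hexpW W₂ hgW₂, hexpW W₃ hgW₃, hexpW W₄ hgW₄, ← Submonoid.coe_mul, ← Submonoid.coe_mul, ← Submonoid.coe_mul, ← Submonoid.coe_mul]
    have hw : W₁ i * W₂ (τp i) * W₃ (τp i) * W₄ i * H₀ =
        holAt U (walk (emb Q.src) (stairWord i.2.1 (off i.1))) * rect U (Site.blockSite Q.src i.1) Q.μ Q.ν P.L P.L *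
          (holAt U (walk (emb Q.src) (stairWord i.2.1 (off i.1))))⁻¹ := by
      rw [hτp]; exact memberWord_eq_conj_rect hj U Q i
    rw [hw]
  have hchainU₀ : ∀ i : Idx P, mlog (exp (b₁ i) * exp (b₂ (τp i)) * exp (b₃ ((1 : Equiv.Perm (Idx P)) (τp i))) *
      exp (b₄ (τp ((1 : Equiv.Perm (Idx P)) (τp i)))) * (H₀' : Matrix n n ℂ)) =
      mlog ((holAt U₀ (walk (emb Q.src) (stairWord i.2.1 (off i.1))) * rect U₀ (Site.blockSite Q.src i.1) Q.μ Q.ν P.L P.L *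
        (holAt U₀ (walk (emb Q.src) (stairWord i.2.1 (off i.1))))⁻¹ : Matrix.specialUnitaryGroup n ℂ) : Matrix n n ℂ) := fun i => by
    rw [hone, hττ, hb₁, hb₂, hb₃, hb₄]
    simp only
    rw [hexpW V₁ hgV₁, hexpW V₂ hgV₂, hexpW V₃ hgV₃, hexpW V₄ hgV₄, ← Submonoid.coe_mul, ← Submonoid.coe_mul, ← Submonoid.coe_mul, ← Submonoid.coe_mul]
    have hw : V₁ i * V₂ (τp i) * V₃ (τp i) * V₄ i * H₀' =
        holAt U₀ (walk (emb Q.src) (stairWord i.2.1 (off i.1))) * rect U₀ (Site.blockSite Q.src i.1) Q.μ Q.ν P.L P.L *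
          (holAt U₀ (walk (emb Q.src) (stairWord i.2.1 (off i.1))))⁻¹ := by
      rw [hτp]; exact memberWord_eq_conj_rect hj U₀ Q i
    rw [hw]
  -- the relative main term in log currency (✓`…RelativeMemberLetters`)
  have hLθ : (P.L : ℝ) ^ 2 * θ ≤ 1 / 2 := hL2.trans hτh
  have hmain := mean_norm_mlog_conjRect_sub_le hj U U₀ hθ0 hLθ hU hU₀ Q hS hdev
  have hΔC : ‖((Fintype.card (Idx P) : ℝ))⁻¹ • ∑ i, mlog (exp (a₁ i) * exp (a₂ (τp i)) * exp (a₃ ((1 : Equiv.Perm (Idx P)) (τp i))) *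
        exp (a₄ (τp ((1 : Equiv.Perm (Idx P)) (τp i)))) * (H₀ : Matrix n n ℂ)) -
      ((Fintype.card (Idx P) : ℝ))⁻¹ • ∑ i, mlog (exp (b₁ i) * exp (b₂ (τp i)) * exp (b₃ ((1 : Equiv.Perm (Idx P)) (τp i))) *
        exp (b₄ (τp ((1 : Equiv.Perm (Idx P)) (τp i)))) * (H₀' : Matrix n n ℂ))‖ ≤
      (1 + 2 * ((P.L : ℝ) ^ 2 * θ)) *
        (∑ p : Plaq P j, ((P.L : ℝ) ^ P.d)⁻¹ * (((block Q.src).filter (fun x : Site P j => p.μ = Q.μ ∧ p.ν = Q.ν ∧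
            ∃ a ∈ range P.L, ∃ b ∈ range P.L, p.src = shiftN (shiftN x Q.μ a) Q.ν b)).card : ℝ) *
            dist1 ((GaugeField.plaqHol U₀ p)⁻¹ * GaugeField.plaqHol U p) +
          4 * (P.L : ℝ) ^ 3 * θ * γ + 2 * ((P.L : ℝ) ^ 2 * θ) * β) := by
    rw [← smul_sub, ← Finset.sum_sub_distrib]
    refine (norm_mean_le_mean _ _ fun i => le_rfl).trans ?_
    simp only [hchainU, hchainU₀]
    exact hmain
  -- ### (6) the split `log Ū − log Ū₀ = ΔJ₁₀ − ΔJ₁₄ + Δchain` and the exit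
  set Xa := mlog (exp (((Fintype.card (Idx P) : ℝ))⁻¹ • ∑ i, a₁ i) * exp (((Fintype.card (Idx P) : ℝ))⁻¹ • ∑ i, a₂ i) *
      exp (((Fintype.card (Idx P) : ℝ))⁻¹ • ∑ i, a₃ i) * exp (((Fintype.card (Idx P) : ℝ))⁻¹ • ∑ i, a₄ i) * (H₀ : Matrix n n ℂ)) with hXa
  set Xb := mlog (exp (((Fintype.card (Idx P) : ℝ))⁻¹ • ∑ i, b₁ i) * exp (((Fintype.card (Idx P) : ℝ))⁻¹ • ∑ i, b₂ i) *
      exp (((Fintype.card (Idx P) : ℝ))⁻¹ • ∑ i, b₃ i) * exp (((Fintype.card (Idx P) : ℝ))⁻¹ • ∑ i, b₄ i) * (H₀' : Matrix n n ℂ)) with hXb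
  set Na := ((Fintype.card (Idx P) : ℝ))⁻¹ • ∑ i, ((Fintype.card (Idx P) : ℝ))⁻¹ • ∑ j, ((Fintype.card (Idx P) : ℝ))⁻¹ • ∑ k,
      ((Fintype.card (Idx P) : ℝ))⁻¹ • ∑ l, mlog (exp (a₁ i) * exp (a₂ j) * exp (a₃ k) * exp (a₄ l) * (H₀ : Matrix n n ℂ)) with hNa
  set Nb := ((Fintype.card (Idx P) : ℝ))⁻¹ • ∑ i, ((Fintype.card (Idx P) : ℝ))⁻¹ • ∑ j, ((Fintype.card (Idx P) : ℝ))⁻¹ • ∑ k,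
      ((Fintype.card (Idx P) : ℝ))⁻¹ • ∑ l, mlog (exp (b₁ i) * exp (b₂ j) * exp (b₃ k) * exp (b₄ l) * (H₀' : Matrix n n ℂ)) with hNb
  set Ca := ((Fintype.card (Idx P) : ℝ))⁻¹ • ∑ i, mlog (exp (a₁ i) * exp (a₂ (τp i)) * exp (a₃ ((1 : Equiv.Perm (Idx P)) (τp i))) *
        exp (a₄ (τp ((1 : Equiv.Perm (Idx P)) (τp i)))) * (H₀ : Matrix n n ℂ)) with hCa
  set Cb := ((Fintype.card (Idx P) : ℝ))⁻¹ • ∑ i, mlog (exp (b₁ i) * exp (b₂ (τp i)) * exp (b₃ ((1 : Equiv.Perm (Idx P)) (τp i))) *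
        exp (b₄ (τp ((1 : Equiv.Perm (Idx P)) (τp i)))) * (H₀' : Matrix n n ℂ)) with hCb
  have hsplit : Xa - Xb = ((Xa - Na) - (Xb - Nb)) - ((Ca - Na) - (Cb - Nb)) + (Ca - Cb) := by abel
  have hMM : ‖Xa - Xb‖ ≤ 4096 * (Real.exp (32 * (2 * τ)) - 1) * (4 * β) +
      4096 * ((Real.exp (24 * (2 * τ)) - 1) + (Real.exp (16 * (2 * τ)) - 1) + (Real.exp (8 * (2 * τ)) - 1)) * (4 * β) +
      (1 + 2 * ((P.L : ℝ) ^ 2 * θ)) *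
        (∑ p : Plaq P j, ((P.L : ℝ) ^ P.d)⁻¹ * (((block Q.src).filter (fun x : Site P j => p.μ = Q.μ ∧ p.ν = Q.ν ∧
            ∃ a ∈ range P.L, ∃ b ∈ range P.L, p.src = shiftN (shiftN x Q.μ a) Q.ν b)).card : ℝ) *
            dist1 ((GaugeField.plaqHol U₀ p)⁻¹ * GaugeField.plaqHol U p) +
          4 * (P.L : ℝ) ^ 3 * θ * γ + 2 * ((P.L : ℝ) ^ 2 * θ) * β) := by
    rw [hsplit]
    refine (norm_add_le _ _).trans (add_le_add ((norm_sub_le _ _).trans (add_le_add hJ₁₀ hJ₁₄)) hΔC)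
  -- the exit: relative size from relative logarithm
  have hXU : dist1 (GaugeField.plaqHol (avgFun ℰ U) Q) < 1 := hplaqU.trans_lt (by linarith only [hτs])
  have hXU₀ : dist1 (GaugeField.plaqHol (avgFun ℰ U₀) Q) < 1 := hplaqU₀.trans_lt (by linarith only [hτs])
  have hexit := dist1_rel_le_mul_norm_mlog_sub (GaugeField.plaqHol (avgFun ℰ U) Q) (GaugeField.plaqHol (avgFun ℰ U₀) Q) hXU hXU₀ hm50U hm50U₀
  rw [hplaqMU, hplaqMU₀] at hexit
  -- ### (7) numerics: `e^{x} − 1 ≤ 2x` on `[0, 1]`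
  have hex : ∀ {x : ℝ}, 0 ≤ x → x ≤ 1 → Real.exp x - 1 ≤ 2 * x := fun {x} hx0 hx1 => by
    have h := Real.abs_exp_sub_one_le (x := x) (by rw [abs_of_nonneg hx0]; exact hx1)
    rw [abs_of_nonneg (by linarith [Real.add_one_le_exp x]), abs_of_nonneg hx0] at h
    exact h
  have E64 : Real.exp (32 * (2 * τ)) - 1 ≤ 2 * (64 * τ) := by rw [show 32 * (2 * τ) = 64 * τ by ring]; exact hex (by linarith only [hτ0]) (by linarith only [hτs])
  have E48 : Real.exp (24 * (2 * τ)) - 1 ≤ 2 * (48 * τ) := by rw [show 24 * (2 * τ) = 48 * τ by ring]; exact hex (by linarith only [hτ0]) (by linarith only [hτs])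
  have E32 : Real.exp (16 * (2 * τ)) - 1 ≤ 2 * (32 * τ) := by rw [show 16 * (2 * τ) = 32 * τ by ring]; exact hex (by linarith only [hτ0]) (by linarith only [hτs])
  have E16 : Real.exp (8 * (2 * τ)) - 1 ≤ 2 * (16 * τ) := by rw [show 8 * (2 * τ) = 16 * τ by ring]; exact hex (by linarith only [hτ0]) (by linarith only [hτs])
  have E50 : Real.exp (50 * τ) ≤ 1 + 100 * τ := by
    have h := hex (x := 50 * τ) (by linarith only [hτ0]) (by linarith only [hτs]); linarith only [h]
  -- names for the main sum and sizes
  have hS0 : 0 ≤ ∑ p : Plaq P j, ((P.L : ℝ) ^ P.d)⁻¹ * (((block Q.src).filter (fun x : Site P j => p.μ = Q.μ ∧ p.ν = Q.ν ∧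
      ∃ a ∈ range P.L, ∃ b ∈ range P.L, p.src = shiftN (shiftN x Q.μ a) Q.ν b)).card : ℝ) * dist1 ((GaugeField.plaqHol U₀ p)⁻¹ * GaugeField.plaqHol U p) :=
    Finset.sum_nonneg fun p _ => mul_nonneg (mul_nonneg (inv_nonneg.mpr (pow_nonneg (Nat.cast_nonneg _) _)) (Nat.cast_nonneg _)) (GaugeGroup.dist1_nonneg _)
  have hγ0 : 0 ≤ γ := by
    have h := hdev ⟨emb Q.src, Q.μ⟩ (fun κ => Or.inl (by rw [Site.blockOf_emb hj]))
    exact (GaugeGroup.dist1_nonneg _).trans h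
  generalize hSg : (∑ p : Plaq P j, ((P.L : ℝ) ^ P.d)⁻¹ * (((block Q.src).filter (fun x : Site P j => p.μ = Q.μ ∧ p.ν = Q.ν ∧
      ∃ a ∈ range P.L, ∃ b ∈ range P.L, p.src = shiftN (shiftN x Q.μ a) Q.ν b)).card : ℝ) * dist1 ((GaugeField.plaqHol U₀ p)⁻¹ * GaugeField.plaqHol U p)) = S
    at hMM hS0 ⊢
  have hL0 : (0 : ℝ) ≤ (P.L : ℝ) ^ 3 * θ := by positivity
  have hs : (P.L : ℝ) ^ 2 * θ ≤ τ := hL2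
  have hs0 : 0 ≤ (P.L : ℝ) ^ 2 * θ := by positivity
  -- ‖Xa − Xb‖ ≤ R₁ := 5242880·τβ + (1 + 2τ)(S + 4L³θγ + 2τβ)
  have hR : ‖Xa - Xb‖ ≤ 5242880 * τ * β + (1 + 2 * τ) * (S + 4 * ((P.L : ℝ) ^ 3 * θ) * γ + 2 * τ * β) := by
    have h1 : 4096 * (Real.exp (32 * (2 * τ)) - 1) * (4 * β) +
        4096 * ((Real.exp (24 * (2 * τ)) - 1) + (Real.exp (16 * (2 * τ)) - 1) + (Real.exp (8 * (2 * τ)) - 1)) * (4 * β) ≤ 5242880 * τ * β := by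
      have Esum : (Real.exp (32 * (2 * τ)) - 1) + ((Real.exp (24 * (2 * τ)) - 1) + (Real.exp (16 * (2 * τ)) - 1) + (Real.exp (8 * (2 * τ)) - 1)) ≤ 320 * τ := by
        linarith only [E64, E48, E32, E16]
      have hm := mul_le_mul_of_nonneg_left Esum (show (0 : ℝ) ≤ 4096 * (4 * β) by linarith only [hβ0])
      calc 4096 * (Real.exp (32 * (2 * τ)) - 1) * (4 * β) +
            4096 * ((Real.exp (24 * (2 * τ)) - 1) + (Real.exp (16 * (2 * τ)) - 1) + (Real.exp (8 * (2 * τ)) - 1)) * (4 * β)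
          = 4096 * (4 * β) * ((Real.exp (32 * (2 * τ)) - 1) + ((Real.exp (24 * (2 * τ)) - 1) + (Real.exp (16 * (2 * τ)) - 1) + (Real.exp (8 * (2 * τ)) - 1))) := by ring
        _ ≤ 4096 * (4 * β) * (320 * τ) := hm
        _ = 5242880 * τ * β := by ring
    have h2 : (1 + 2 * ((P.L : ℝ) ^ 2 * θ)) * (S + 4 * (P.L : ℝ) ^ 3 * θ * γ + 2 * ((P.L : ℝ) ^ 2 * θ) * β) ≤
        (1 + 2 * τ) * (S + 4 * ((P.L : ℝ) ^ 3 * θ) * γ + 2 * τ * β) := by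
      have hsβ := mul_le_mul_of_nonneg_right hs hβ0
      have hin : S + 4 * (P.L : ℝ) ^ 3 * θ * γ + 2 * ((P.L : ℝ) ^ 2 * θ) * β ≤ S + 4 * ((P.L : ℝ) ^ 3 * θ) * γ + 2 * τ * β := by
        linarith only [hsβ]
      have hsβ0 : 0 ≤ (P.L : ℝ) ^ 2 * θ * β := mul_nonneg hs0 hβ0
      have hLγ0 : 0 ≤ (P.L : ℝ) ^ 3 * θ * γ := mul_nonneg hL0 hγ0
      have hin0 : 0 ≤ S + 4 * (P.L : ℝ) ^ 3 * θ * γ + 2 * ((P.L : ℝ) ^ 2 * θ) * β := by linarith only [hS0, hsβ0, hLγ0]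
      calc (1 + 2 * ((P.L : ℝ) ^ 2 * θ)) * (S + 4 * (P.L : ℝ) ^ 3 * θ * γ + 2 * ((P.L : ℝ) ^ 2 * θ) * β)
          ≤ (1 + 2 * τ) * (S + 4 * (P.L : ℝ) ^ 3 * θ * γ + 2 * ((P.L : ℝ) ^ 2 * θ) * β) := mul_le_mul_of_nonneg_right (by linarith only [hs]) hin0
        _ ≤ (1 + 2 * τ) * (S + 4 * ((P.L : ℝ) ^ 3 * θ) * γ + 2 * τ * β) := mul_le_mul_of_nonneg_left hin (by linarith only [hτ0])
    linarith only [hMM, h1, h2]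
  have hτβ0 : 0 ≤ τ * β := mul_nonneg hτ0 hβ0
  have hLγ0 : 0 ≤ (P.L : ℝ) ^ 3 * θ * γ := mul_nonneg hL0 hγ0
  have hB0 : 0 ≤ S + 4 * ((P.L : ℝ) ^ 3 * θ) * γ + 2 * τ * β := by linarith only [hS0, hLγ0, hτβ0]
  have hR0 : 0 ≤ 5242880 * τ * β + (1 + 2 * τ) * (S + 4 * ((P.L : ℝ) ^ 3 * θ) * γ + 2 * τ * β) := by
    have := mul_nonneg (show (0:ℝ) ≤ 1 + 2 * τ by linarith only [hτ0]) hB0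
    linarith only [this, hτβ0]
  -- dist1 ≤ e^{50τ}·‖Xa − Xb‖ ≤ (1 + 100τ)·R₁ ≤ the stated bound
  have hfin : dist1 ((GaugeField.plaqHol (avgFun ℰ U₀) Q)⁻¹ * GaugeField.plaqHol (avgFun ℰ U) Q) ≤
      (1 + 100 * τ) * (5242880 * τ * β + (1 + 2 * τ) * (S + 4 * ((P.L : ℝ) ^ 3 * θ) * γ + 2 * τ * β)) :=
    hexit.trans (mul_le_mul E50 hR (norm_nonneg _) (by linarith only [hτ0]))
  have hc1 : (1 + 100 * τ) * (1 + 2 * τ) ≤ 1 + 104 * τ := by nlinarith only [hτs, hτ0]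
  have hc2 : (1 + 100 * τ) * (5242880 * τ) + (1 + 104 * τ) * (2 * τ) ≤ 6000000 * τ := by nlinarith only [hτs, hτ0]
  have hc3 : (1 + 104 * τ) * 4 ≤ 5 := by linarith only [hτs]
  have step : (1 + 100 * τ) * (5242880 * τ * β + (1 + 2 * τ) * (S + 4 * ((P.L : ℝ) ^ 3 * θ) * γ + 2 * τ * β)) ≤
      (1 + 104 * τ) * S + 6000000 * τ * β + 5 * ((P.L : ℝ) ^ 3 * θ) * γ := by
    have e1 : (1 + 100 * τ) * ((1 + 2 * τ) * (S + 4 * ((P.L : ℝ) ^ 3 * θ) * γ + 2 * τ * β)) ≤ (1 + 104 * τ) * (S + 4 * ((P.L : ℝ) ^ 3 * θ) * γ + 2 * τ * β) := by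
      rw [← mul_assoc]; exact mul_le_mul_of_nonneg_right hc1 hB0
    have e2 : (1 + 104 * τ) * (4 * ((P.L : ℝ) ^ 3 * θ) * γ) ≤ 5 * ((P.L : ℝ) ^ 3 * θ) * γ := by
      have h := mul_le_mul_of_nonneg_right hc3 (mul_nonneg hL0 hγ0)
      calc (1 + 104 * τ) * (4 * ((P.L : ℝ) ^ 3 * θ) * γ) = (1 + 104 * τ) * 4 * ((P.L : ℝ) ^ 3 * θ * γ) := by ring
        _ ≤ 5 * ((P.L : ℝ) ^ 3 * θ * γ) := h
        _ = 5 * ((P.L : ℝ) ^ 3 * θ) * γ := by ring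
    have e3 : (1 + 100 * τ) * (5242880 * τ * β) + (1 + 104 * τ) * (2 * τ * β) ≤ 6000000 * τ * β := by
      have h := mul_le_mul_of_nonneg_right hc2 hβ0
      calc (1 + 100 * τ) * (5242880 * τ * β) + (1 + 104 * τ) * (2 * τ * β)
          = ((1 + 100 * τ) * (5242880 * τ) + (1 + 104 * τ) * (2 * τ)) * β := by ring
        _ ≤ 6000000 * τ * β := h
    nlinarith only [e1, e2, e3]
  have h4 : 1 + 26 * (4 * τ) = 1 + 104 * τ := by ring
  have h5 : 1500000 * (4 * τ) * β = 6000000 * τ * β := by ring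
  rw [h4τ, h4, h5]
  calc dist1 ((GaugeField.plaqHol (avgFun ℰ U₀) Q)⁻¹ * GaugeField.plaqHol (avgFun ℰ U) Q) ≤ _ := hfin
    _ ≤ (1 + 104 * τ) * S + 6000000 * τ * β + 5 * ((P.L : ℝ) ^ 3 * θ) * γ := step
    _ = (1 + 104 * τ) * S + 6000000 * τ * β + 5 * (P.L : ℝ) ^ 3 * θ * γ := by ring

end Summit.QuantumFields.YangMills.Theorems.FluctuationComparisonRegPrIntLS2BetaRelativeOneLevelStep

end
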